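/-
Copyright: public-audit package `pub-balaban` (b2b-balaban), seat pv26-g10. Released under Apache 2.0 like Mathlib.
-/
import Literature.MathematicalPhysics.QuantumFieldTheory.Balaban1983to89.T4HaarSU2ExpChart
import Literature.MathematicalPhysics.QuantumFieldTheory.Balaban1983to89.T4CubeChartGnomonic

/-!
# T4 — the cube chart of the `SU(2)` fibre in the EXPONENTIAL window: caveat (CHART) of `T4CubeChartTransport`
# discharged for the production-type group with the chart print uses

* Value = kernel certificate that the hypothesis class `CubeChart` of the Brascamp–Lieb transport
  (`T4CubeChartTransport`) is INHABITED by the production-type group fibre `(s → SU(2))` with the cell's own `HaarData`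
  and the EXPONENTIAL chart — the chart print uses for its small-field windows — with the honest non-constant Jacobian
  `∏_b (2π²)⁻¹ (sin|v_b|/|v_b|)²`; NOT summit progress; NOT continuum; NOT Clay.
* Everything here is [folklore]: NO printed sentence is asserted, nothing internally minted is cited (ABSOLUTE RULE).
  The two inputs are tree theorems used BY NAME: the one-bond exponential-chart Haar identity
  `T4HaarSU2ExpChart.haarProbability_restrict_image` (with `injOn_expPoint`, `cube_subset_ball`, `expWeight`,
  `expMeasure`; lineage pv26) and the bond-regrouping machinery of `T4CubeChartGnomonic` (`regroup`,
  `measurePreserving_regroup`, `regroup_preimage_pi_cube`, `bondCoordEquiv`; lineage pv28), whose §1–§5 this file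
  follows line by line with the gnomonic chart `v ↦ g·P(1,v)` replaced by `v ↦ g·exp(ι v)`. Nothing of either is
  re-proved or modified.

## Content

* §1 `expPt v = exp(v₀ i + v₁ j + v₂ k) ∈ SU(2)` (`= T4HaarSU2ExpChart.expPoint (toE v)`, `toE = WithLp.toLp 2`), the chart
  `expChart g v = g · expPt v`, continuity, `expChart_zero`, and INJECTIVITY ON THE CUBE `[-S,S]³` for `3S² < π²`
  (`injOn_expPt`, `injOn_expChart`; the cube sits inside the injectivity ball `‖x‖ < π`, `toE_mem_ball_of_mem_cube`).
* §2 the window `expWindow g S = expChart g '' [-S,S]³` (compact, measurable, contains `g`, left translate of the window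
  about `1`), the weight `expCubeWeight v = (2π²)⁻¹ sinc²‖toE v‖`, the measure `expCubeMeasure S = w 1_{[-S,S]³} dv`, and
  **`haar_restrict_expWindow`**: `HaarData.haar ⌊ expWindow g S = (expCubeMeasure S).map (expChart g)` for `3S² < π²`
  (`measurePreserving_expChart`, `haar_expWindow`, `haar_expWindow_eq_ofReal`); positivity of the window mass
  (`haar_expWindow_pos`, `0 < S`, `3S² < π²`) and the explicit Jordan lower bound `w ≥ (2π²)⁻¹(2/π)²` on cubes with
  `12 S² ≤ π²` (`expCubeWeight_ge_of_mem_cube`, `le_haar_expWindow`, `le_integral_expCubeWeight`).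
* §3 the log-Jacobian `expJac s e x = Σ_b ρ(x_{e(b,·)})`, `ρ = −log w` (measurable; `e^{−jac} = ∏_b w` ON THE CUBE,
  `exp_neg_expJac`), and **`map_regroup_cubeWeighted`**: `(Ψ_e)_*(e^{−jac_e} 1_{[-S,S]ⁿ} dx) = ⨂_b expCubeMeasure S`.
* §4 the product window density `expWindowDensity s u₀ S`, the fibre chart `expFibreChart s u₀ e`, and
  **`cubeChart_specialUnitaryTwo_exp`**: `CubeChart s (expWindowDensity s u₀ S) u₀ n S (expFibreChart s u₀ e) (expJac s e)`
  for `0 < S`, `3S² < π²` (+ `_card` with `n = 3·#s`, `exists_…` with injectivity of the chart on the big cube).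
* §5 the consumers' provisos: `fibreIntegral_expWindowDensity` (= `(∫_{[-S,S]³} w)^{#s}`), its positivity and explicit
  lower bound, `fibreIntegral_expWindowDensity_mul_exp_ne_zero`, `expWindowDensity_mul_exp_le`.

## Caveats

* (WINDOW ≠ PRINT) The window here is a product of per-bond sup-norm cubes in exponential coordinates about `u₀`.
  Bałaban's small-field condition is on PLAQUETTE variables (`|U(∂p) − 1| < ε`) after an axial gauge, and the printed
  claim that ONE chart covers that window ((N1)) and the (β3) bookkeeping are NOT touched — this file is chart geometry.
* (RADIUS) Every measure identity carries `3S² < π²` (`S < π/√3 ≈ 1.81`): the closed cube must sit inside the open ball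
  `‖x‖ < π` on which `exp ∘ ι` is injective; beyond it the identities are false (double counting). The explicit lower
  bounds carry the stronger `12 S² ≤ π²` (Jordan's inequality needs `‖x‖ ≤ π/2`); positivity only needs `3S² < π²`.
* (JAC) `expJac` is defined with Mathlib's junk `log 0 = 0` off the chart balls and is only ever evaluated on the cube.
  Its smoothness and Hessian on the chart domain (`−2 Σ_b log sinc|v_b|` is real-analytic and convex there, `= Σ_b |v_b|²/3
  + O(|v|⁴)`) are NOT typed here — unlike `T4CubeChartGnomonic` §6 no `HessianBound` is provided; consumers needing one
  for the exponential chart do not get it from this file.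
* (RANK) `SU(2)` only.
-/

noncomputable section

open _root_.MeasureTheory Set Metric
open Function (updateFinset)
open scoped ENNReal Real Quaternion

namespace Literature.MathematicalPhysics.QuantumFieldTheory.Balaban1983to89.T4CubeChartExp

open Literature.MathematicalPhysics.QuantumLattice (quatToSU2)
open Literature.MathematicalPhysics.QuantumFieldTheory (haarProbability)
open Literature.Probability.Distributions (isCompact_cube integrableOn_cube)
open Literature.MathematicalPhysics.QuantumFieldTheory.GaussianToolkit (lintegral_fintype_prod_eq_prod)
open T4HaarSU2Translate (haarData_haar_eq)
open T4HaarSU2ExpChart (imQuat expPoint continuous_expPoint measurable_expPoint injOn_expPoint expPoint_zero expWeight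
  expWeight_nonneg expWeight_le expWeight_pos continuous_expWeight measurable_expWeight expMeasure
  measurableSet_image_expPoint haarProbability_restrict_image cube_subset_ball)
open T4CubeChartGnomonic (SU2 isCompact_cube₃ zero_mem_cube₃ volume_cube₃_toReal regroup regroup_apply regroup_apply_eq
  measurePreserving_regroup regroup_preimage_pi_cube bondCoordEquiv)
open T4TiltModulus T4CubePoincare T4CubeChartTransport

/-! ## §1  The exponential chart on sup-norm coordinates `v ↦ g · exp(ι v)` -/

/-- The Euclidean point of a coordinate vector `v : Fin 3 → ℝ` (Mathlib `WithLp.toLp 2`). [folklore] -/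
abbrev toE (v : Fin 3 → ℝ) : EuclideanSpace ℝ (Fin 3) := WithLp.toLp 2 v

/-- `‖toE v‖² = Σᵢ vᵢ²`. [folklore] -/
theorem norm_toE_sq (v : Fin 3 → ℝ) : ‖toE v‖ ^ 2 = ∑ i, v i ^ 2 := by
  rw [EuclideanSpace.real_norm_sq_eq]

/-- THE ONE-BOND EXPONENTIAL POINT `exp(ι v) = exp(v₀ i + v₁ j + v₂ k) ∈ SU(2)` of a coordinate vector
(`T4HaarSU2ExpChart.expPoint` on `toE v`). [folklore] -/
def expPt (v : Fin 3 → ℝ) : SU2 := expPoint (toE v)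

/-- THE EXPONENTIAL CHART ABOUT `g`: `v ↦ g · exp(ι v)`. [folklore] -/
def expChart (g : SU2) (v : Fin 3 → ℝ) : SU2 := g * expPt v

/-- `v ↦ exp(ι v)` is continuous. [folklore] -/
theorem continuous_expPt : Continuous expPt :=
  continuous_expPoint.comp (PiLp.continuous_toLp 2 _ : Continuous toE)

/-- `v ↦ g exp(ι v)` is continuous. [folklore] -/
theorem continuous_expChart (g : SU2) : Continuous (expChart g) := continuous_const.mul continuous_expPt

/-- `v ↦ g exp(ι v)` is measurable. [folklore] -/
theorem measurable_expChart (g : SU2) : Measurable (expChart g) := (continuous_expChart g).measurable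

/-- `exp(ι 0) = 1`. [folklore] -/
theorem expPt_zero : expPt 0 = 1 := by
  rw [expPt, show toE 0 = 0 from rfl, expPoint_zero]

/-- The chart is centred: `g exp(ι 0) = g`. [folklore] -/
theorem expChart_zero (g : SU2) : expChart g 0 = g := by
  rw [expChart, expPt_zero, mul_one]

/-- THE INJECTIVITY RADIUS IN SUP-NORM: the closed cube `[-S,S]³` with `3S² < π²` is carried by `toE` into the open ball
`‖x‖ < π` on which the exponential chart is injective (`T4HaarSU2ExpChart.cube_subset_ball`). [folklore] -/
theorem toE_mem_ball_of_mem_cube {S : ℝ} (hSπ : 3 * S ^ 2 < π ^ 2) {v : Fin 3 → ℝ} (hv : v ∈ cube 3 S) :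
    toE v ∈ ball (0 : EuclideanSpace ℝ (Fin 3)) π :=
  cube_subset_ball hSπ (show ∀ i, |(toE v) i| ≤ S from fun i => mem_cube_iff.1 hv i)

/-- `toE '' [-S,S]³ ⊆ {‖x‖ < π}` for `3S² < π²`. [folklore] -/
theorem image_toE_cube_subset_ball {S : ℝ} (hSπ : 3 * S ^ 2 < π ^ 2) :
    toE '' cube 3 S ⊆ ball (0 : EuclideanSpace ℝ (Fin 3)) π := by
  rintro _ ⟨v, hv, rfl⟩
  exact toE_mem_ball_of_mem_cube hSπ hv

/-- `toE '' [-S,S]³` is measurable (image under a measurable equivalence). [folklore] -/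
theorem measurableSet_image_toE_cube (S : ℝ) : MeasurableSet (toE '' cube 3 S) := by
  rw [show toE = ⇑(MeasurableEquiv.toLp 2 (Fin 3 → ℝ)) from (MeasurableEquiv.coe_toLp 2 (Fin 3 → ℝ)).symm]
  exact (MeasurableEquiv.toLp 2 (Fin 3 → ℝ)).measurableSet_image.2 (measurableSet_cube' 3 S)

/-- **INJECTIVITY OF THE EXPONENTIAL CHART ON THE CUBE**: `v ↦ exp(ι v)` is injective on `[-S,S]³` when `3S² < π²`.
[folklore] -/
theorem injOn_expPt {S : ℝ} (hSπ : 3 * S ^ 2 < π ^ 2) : InjOn expPt (cube 3 S) := fun _ hv _ hw h =>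
  (WithLp.toLp_injective 2) (injOn_expPoint (toE_mem_ball_of_mem_cube hSπ hv) (toE_mem_ball_of_mem_cube hSπ hw) h)

/-- … and so is `v ↦ g exp(ι v)`. [folklore] -/
theorem injOn_expChart (g : SU2) {S : ℝ} (hSπ : 3 * S ^ 2 < π ^ 2) : InjOn (expChart g) (cube 3 S) :=
  fun _ hv _ hw h => injOn_expPt hSπ hv hw (mul_left_cancel h)

/-! ## §2  The exponential cube window and the Haar measure on it -/

section Window

variable {g : SU2} {S : ℝ}

/-- THE EXPONENTIAL CUBE WINDOW of half-width `S` about `g ∈ SU(2)`: `{g · exp(ι v) : v ∈ [-S,S]³}`. [folklore] -/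
def expWindow (g : SU2) (S : ℝ) : Set SU2 := expChart g '' cube 3 S

/-- The window is compact. [folklore] -/
theorem isCompact_expWindow : IsCompact (expWindow g S) := (isCompact_cube₃ S).image (continuous_expChart g)

/-- The window is measurable. [folklore] -/
theorem measurableSet_expWindow : MeasurableSet (expWindow g S) := isCompact_expWindow.isClosed.measurableSet

/-- The centre lies in its window (`S ≥ 0`). [folklore] -/
theorem mem_expWindow_self (hS : 0 ≤ S) : g ∈ expWindow g S := ⟨0, zero_mem_cube₃ hS, expChart_zero g⟩

/-- The window about `1` is the set of exponential points of the cube. [folklore] -/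
theorem expWindow_one : expWindow 1 S = expPt '' cube 3 S :=
  image_congr fun v _ => by rw [expChart, one_mul]

/-- … equivalently the `expPoint`-image of the Euclidean cube `toE '' [-S,S]³`. [folklore] -/
theorem expWindow_one_eq_image_image : expWindow 1 S = expPoint '' (toE '' cube 3 S) := by
  rw [expWindow_one, image_image]
  rfl

/-- The window about `g` is the left translate of the window about `1`. [folklore] -/
theorem expWindow_eq_image_mul (g : SU2) (S : ℝ) : expWindow g S = (fun h : SU2 => g * h) '' expWindow 1 S := by
  rw [expWindow_one, image_image]
  rfl

/-- THE EXPONENTIAL HAAR WEIGHT in coordinates: `w(v) = (2π²)⁻¹ sinc²‖toE v‖ = (2π²)⁻¹ (sin|v|/|v|)²`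
(`T4HaarSU2ExpChart.expWeight`). [folklore] -/
def expCubeWeight (v : Fin 3 → ℝ) : ℝ := expWeight (toE v)

/-- `w ≥ 0`. [folklore] -/
theorem expCubeWeight_nonneg (v : Fin 3 → ℝ) : 0 ≤ expCubeWeight v := expWeight_nonneg _

/-- `w ≤ (2π²)⁻¹`. [folklore] -/
theorem expCubeWeight_le (v : Fin 3 → ℝ) : expCubeWeight v ≤ (2 * π ^ 2)⁻¹ := expWeight_le _

/-- `w > 0` on the cube `[-S,S]³`, `3S² < π²`. [folklore] -/
theorem expCubeWeight_pos_of_mem_cube (hSπ : 3 * S ^ 2 < π ^ 2) {v : Fin 3 → ℝ} (hv : v ∈ cube 3 S) :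
    0 < expCubeWeight v :=
  expWeight_pos (toE_mem_ball_of_mem_cube hSπ hv)

/-- `w` is continuous. [folklore] -/
theorem continuous_expCubeWeight : Continuous expCubeWeight :=
  continuous_expWeight.comp (PiLp.continuous_toLp 2 _ : Continuous toE)

/-- `w` is measurable. [folklore] -/
theorem measurable_expCubeWeight : Measurable expCubeWeight := continuous_expCubeWeight.measurable

/-- THE EXPONENTIAL MEASURE on the cube: `w(v) 1_{[-S,S]³}(v) dv`. [folklore] -/
def expCubeMeasure (S : ℝ) : Measure (Fin 3 → ℝ) :=
  (volume.restrict (cube 3 S)).withDensity fun v => ENNReal.ofReal (expCubeWeight v)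

/-- The exponential measure on a cube is finite. [folklore] -/
instance isFiniteMeasure_expCubeMeasure (S : ℝ) : IsFiniteMeasure (expCubeMeasure S) := by
  refine isFiniteMeasure_withDensity (ne_top_of_le_ne_top ?_
    (lintegral_mono fun v => ENNReal.ofReal_le_ofReal (expCubeWeight_le v)))
  rw [lintegral_const, Measure.restrict_apply_univ]
  exact ENNReal.mul_ne_top ENNReal.ofReal_ne_top (isCompact_cube₃ S).measure_lt_top.ne

/-- TRANSPORT TO THE EUCLIDEAN CUBE: `toE_* (w 1_{[-S,S]³} dv) = μ_exp ⌊ (toE '' [-S,S]³)` for `3S² < π²`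
(`toE` preserves Lebesgue measure; `μ_exp = T4HaarSU2ExpChart.expMeasure`). [folklore] -/
theorem map_toE_expCubeMeasure (hSπ : 3 * S ^ 2 < π ^ 2) :
    (expCubeMeasure S).map toE = expMeasure.restrict (toE '' cube 3 S) := by
  have hA : MeasurableSet (toE '' cube 3 S) := measurableSet_image_toE_cube S
  have hAπ := image_toE_cube_subset_ball hSπ
  have hemb : MeasurableEmbedding toE := by
    rw [show toE = ⇑(MeasurableEquiv.toLp 2 (Fin 3 → ℝ)) from (MeasurableEquiv.coe_toLp 2 (Fin 3 → ℝ)).symm]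
    exact (MeasurableEquiv.toLp 2 (Fin 3 → ℝ)).measurableEmbedding
  refine Measure.ext fun t ht => ?_
  have hpre : MeasurableSet (toE ⁻¹' t) := hemb.measurable ht
  rw [Measure.map_apply hemb.measurable ht, expCubeMeasure, withDensity_apply _ hpre, Measure.restrict_restrict hpre,
    expMeasure, ← restrict_withDensity measurableSet_ball, Measure.restrict_restrict hA, inter_eq_left.2 hAπ,
    Measure.restrict_apply ht, withDensity_apply _ (ht.inter hA)]
  have hset : toE ⁻¹' t ∩ cube 3 S = toE ⁻¹' (t ∩ toE '' cube 3 S) := by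
    rw [preimage_inter, hemb.injective.preimage_image]
  rw [hset]
  have hmp : MeasurePreserving toE volume volume := PiLp.volume_preserving_toLp (Fin 3)
  have h := hmp.setLIntegral_comp_preimage_emb hemb
    (fun x : EuclideanSpace ℝ (Fin 3) => ENNReal.ofReal (expWeight x)) (t ∩ toE '' cube 3 S)
  simpa only [expCubeWeight, Measure.restrict_univ, inter_univ] using h

/-- **NORMALISED HAAR MEASURE ON `SU(2)` IN THE EXPONENTIAL CUBE WINDOW ABOUT `1`**: for `3S² < π²` its restriction to
`{exp(ι v) : v ∈ [-S,S]³}` is the image of `(2π²)⁻¹ sinc²|v| 1_{[-S,S]³} dv` under `v ↦ exp(ι v)` — the one-bond window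
identity `T4HaarSU2ExpChart.haarProbability_restrict_image` on the Euclidean cube, transported to coordinates.
[folklore] -/
theorem haarProbability_restrict_expWindow_one (hSπ : 3 * S ^ 2 < π ^ 2) :
    (haarProbability SU2).restrict (expWindow 1 S) = (expCubeMeasure S).map expPt := by
  have hA : MeasurableSet (toE '' cube 3 S) := measurableSet_image_toE_cube S
  rw [expWindow_one_eq_image_image, haarProbability_restrict_image hA (image_toE_cube_subset_ball hSπ),
    ← map_toE_expCubeMeasure hSπ, Measure.map_map measurable_expPoint
      (PiLp.volume_preserving_toLp (Fin 3) : MeasurePreserving toE volume volume).measurable]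
  rfl

/-- **THE HAAR DATUM ON AN EXPONENTIAL CUBE WINDOW**: for every `g ∈ SU(2)` and `3S² < π²`, the cell's `HaarData.haar`
restricted to `{g exp(ι v) : v ∈ [-S,S]³}` is the image of the exponential measure under `v ↦ g exp(ι v)` (left
invariance of the Haar datum + the window about `1`). [folklore] -/
theorem haar_restrict_expWindow (g : SU2) (hSπ : 3 * S ^ 2 < π ^ 2) :
    (HaarData.haar : Measure SU2).restrict (expWindow g S) = (expCubeMeasure S).map (expChart g) := by
  have hm : Measurable fun h : SU2 => g * h := measurable_const_mul g
  calc (HaarData.haar : Measure SU2).restrict (expWindow g S)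
      = ((HaarData.haar : Measure SU2).map (fun h => g * h)).restrict (expWindow g S) := by
        rw [HaarData.map_mul_left]
    _ = ((HaarData.haar : Measure SU2).restrict ((fun h => g * h) ⁻¹' expWindow g S)).map (fun h => g * h) :=
        Measure.restrict_map hm measurableSet_expWindow
    _ = ((HaarData.haar : Measure SU2).restrict (expWindow 1 S)).map (fun h => g * h) := by
        rw [expWindow_eq_image_mul g S, (mul_right_injective g).preimage_image]
    _ = ((expCubeMeasure S).map expPt).map (fun h => g * h) := by
        rw [haarData_haar_eq, haarProbability_restrict_expWindow_one hSπ]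
    _ = (expCubeMeasure S).map (expChart g) := by
        rw [Measure.map_map hm continuous_expPt.measurable]
        rfl

/-- `v ↦ g exp(ι v)` is measure preserving from the exponential measure on `[-S,S]³` (`3S² < π²`) to the Haar datum
on the window. [folklore] -/
theorem measurePreserving_expChart (g : SU2) (hSπ : 3 * S ^ 2 < π ^ 2) :
    MeasurePreserving (expChart g) (expCubeMeasure S) ((HaarData.haar : Measure SU2).restrict (expWindow g S)) :=
  ⟨measurable_expChart g, (haar_restrict_expWindow g hSπ).symm⟩

/-- The Haar mass of the window as a cube integral: `∫_{[-S,S]³} (2π²)⁻¹ sinc²|v| dv` (`3S² < π²`). [folklore] -/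
theorem haar_expWindow (g : SU2) (hSπ : 3 * S ^ 2 < π ^ 2) :
    (HaarData.haar : Measure SU2) (expWindow g S) = ∫⁻ v in cube 3 S, ENNReal.ofReal (expCubeWeight v) := by
  rw [← Measure.restrict_apply_univ, haar_restrict_expWindow g hSπ, Measure.map_apply (measurable_expChart g)
    MeasurableSet.univ, preimage_univ, expCubeMeasure, withDensity_apply _ MeasurableSet.univ, Measure.restrict_univ]

/-- `w` is integrable on the cube. [folklore] -/
theorem integrableOn_expCubeWeight (S : ℝ) : IntegrableOn expCubeWeight (cube 3 S) volume :=
  integrableOn_cube continuous_expCubeWeight S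

/-- The Haar mass of the window as a REAL cube integral: `Haar(expWindow g S) = ∫_{[-S,S]³} w(v) dv` (`3S² < π²`).
[folklore] -/
theorem haar_expWindow_eq_ofReal (g : SU2) (hSπ : 3 * S ^ 2 < π ^ 2) :
    (HaarData.haar : Measure SU2) (expWindow g S) = ENNReal.ofReal (∫ v in cube 3 S, expCubeWeight v) := by
  rw [haar_expWindow g hSπ, ofReal_integral_eq_lintegral_ofReal (integrableOn_expCubeWeight S)
    (ae_of_all _ fun v => expCubeWeight_nonneg v)]

/-- JORDAN'S BOUND ON THE WEIGHT: on the cube `[-S,S]³` with `12 S² ≤ π²` (so `‖toE v‖ ≤ π/2`) one has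
`sinc‖toE v‖ ≥ 2/π`, hence `w(v) ≥ (2π²)⁻¹ (2/π)² = 2/π⁴` (Mathlib `Real.mul_le_sin`). [folklore] -/
theorem expCubeWeight_ge_of_mem_cube (hS12 : 12 * S ^ 2 ≤ π ^ 2) {v : Fin 3 → ℝ} (hv : v ∈ cube 3 S) :
    (2 * π ^ 2)⁻¹ * (2 / π) ^ 2 ≤ expCubeWeight v := by
  have hr0 : 0 ≤ ‖toE v‖ := norm_nonneg _
  have hsq : ‖toE v‖ ^ 2 ≤ 3 * S ^ 2 := by
    rw [norm_toE_sq, Fin.sum_univ_three]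
    have := fun i => sq_le_sq' (abs_le.1 (mem_cube_iff.1 hv i)).1 (abs_le.1 (mem_cube_iff.1 hv i)).2
    linarith [this 0, this 1, this 2]
  have hrπ : ‖toE v‖ ≤ π / 2 :=
    (pow_le_pow_iff_left₀ hr0 (by positivity) two_ne_zero).1 (by nlinarith [Real.pi_pos])
  have hsinc : 2 / π ≤ Real.sinc ‖toE v‖ := by
    rcases hr0.eq_or_lt with h0 | hpos
    · rw [← h0, Real.sinc_zero]
      rw [div_le_one Real.pi_pos]
      linarith [Real.pi_gt_three]
    · rw [Real.sinc_of_ne_zero hpos.ne', le_div_iff₀ hpos]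
      exact Real.mul_le_sin hr0 hrπ
  unfold expCubeWeight expWeight
  exact mul_le_mul_of_nonneg_left (pow_le_pow_left₀ (by positivity) hsinc 2) (by positivity)

/-- LOWER BOUND: for `12 S² ≤ π²` the window of half-width `S` has Haar mass `≥ (2π²)⁻¹ (2/π)² (2S)³`. [folklore] -/
theorem le_haar_expWindow (g : SU2) (hS12 : 12 * S ^ 2 ≤ π ^ 2) :
    ENNReal.ofReal ((2 * π ^ 2)⁻¹ * (2 / π) ^ 2) * volume (cube 3 S) ≤ (HaarData.haar : Measure SU2) (expWindow g S) := by
  have hSπ : 3 * S ^ 2 < π ^ 2 := by nlinarith [pow_pos Real.pi_pos 2, sq_nonneg S]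
  rw [haar_expWindow g hSπ, ← setLIntegral_const]
  exact setLIntegral_mono (ENNReal.measurable_ofReal.comp measurable_expCubeWeight)
    fun v hv => ENNReal.ofReal_le_ofReal (expCubeWeight_ge_of_mem_cube hS12 hv)

/-- **THE WINDOW HAS POSITIVE HAAR MASS** for `0 < S`, `3S² < π²` (the weight is positive on the cube). [folklore] -/
theorem haar_expWindow_pos (g : SU2) (hS : 0 < S) (hSπ : 3 * S ^ 2 < π ^ 2) :
    0 < (HaarData.haar : Measure SU2) (expWindow g S) := by
  have hwm : Measurable fun v : Fin 3 → ℝ => ENNReal.ofReal (expCubeWeight v) :=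
    ENNReal.measurable_ofReal.comp measurable_expCubeWeight
  rw [haar_expWindow g hSπ, lintegral_pos_iff_support hwm, Measure.restrict_apply' (measurableSet_cube' 3 S)]
  refine lt_of_lt_of_le (volume_cube_pos' 3 hS) (measure_mono fun v hv => ⟨?_, hv⟩)
  exact (ENNReal.ofReal_pos.2 (expCubeWeight_pos_of_mem_cube hSπ hv)).ne'

/-- LOWER BOUND in `ℝ`: `∫_{[-S,S]³} w ≥ (2π²)⁻¹ (2/π)² (2S)³` for `0 ≤ S`, `12 S² ≤ π²`. [folklore] -/
theorem le_integral_expCubeWeight (hS : 0 ≤ S) (hS12 : 12 * S ^ 2 ≤ π ^ 2) :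
    (2 * π ^ 2)⁻¹ * (2 / π) ^ 2 * (2 * S) ^ 3 ≤ ∫ v in cube 3 S, expCubeWeight v := by
  have h := setIntegral_mono_on (μ := volume) (s := cube 3 S) (integrableOn_cube continuous_const S)
    (integrableOn_expCubeWeight S) (measurableSet_cube' 3 S) fun v hv => expCubeWeight_ge_of_mem_cube hS12 hv
  rw [setIntegral_const, smul_eq_mul, measureReal_def, volume_cube₃_toReal hS] at h
  linarith

/-- `∫_{[-S,S]³} w > 0` for `0 < S`, `3S² < π²`. [folklore] -/
theorem integral_expCubeWeight_pos (hS : 0 < S) (hSπ : 3 * S ^ 2 < π ^ 2) : 0 < ∫ v in cube 3 S, expCubeWeight v := by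
  have h := haar_expWindow_pos (1 : SU2) hS hSπ
  rw [haar_expWindow_eq_ofReal 1 hSπ, ENNReal.ofReal_pos] at h
  exact h

end Window

/-! ## §3  The log-Jacobian of the exponential fibre chart, and the regrouped weighted cube -/

section Regroup

variable {P : Params} {j : ℕ} {s : Finset (PBond P j)} {n : ℕ}

/-- THE ONE-BOND LOG-WEIGHT `ρ(v) = -log w(v)` (`w(v) = (2π²)⁻¹ sinc²|v|`; Mathlib's junk value `log 0 = 0` off the
chart ball, where `w` may vanish — immaterial: only the values on cubes `[-S,S]³`, `3S² < π²`, are ever used). [folklore] -/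
def expLogWeight (v : Fin 3 → ℝ) : ℝ := -Real.log (expCubeWeight v)

/-- On the chart ball `e^{-ρ(v)} = w(v)`. [folklore] -/
theorem exp_neg_expLogWeight {S : ℝ} (hSπ : 3 * S ^ 2 < π ^ 2) {v : Fin 3 → ℝ} (hv : v ∈ cube 3 S) :
    Real.exp (-expLogWeight v) = expCubeWeight v := by
  rw [expLogWeight, neg_neg, Real.exp_log (expCubeWeight_pos_of_mem_cube hSπ hv)]

/-- `ρ` is measurable. [folklore] -/
theorem measurable_expLogWeight : Measurable expLogWeight :=
  (Real.measurable_log.comp measurable_expCubeWeight).neg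

/-- **THE LOG-JACOBIAN OF THE EXPONENTIAL FIBRE CHART**: `jac_e(x) = Σ_{b ∈ s} ρ(x_{e(b,·)})`,
`ρ = -log((2π²)⁻¹ sinc²|·|)`, so that `e^{-jac_e(x)} = ∏_b (2π²)⁻¹ sinc²|x_{e(b,·)}|` on the cube (`exp_neg_expJac`).
Caveat (JAC): NOT constant; its smoothness / Hessian on the chart domain is not typed in this file. [folklore] -/
def expJac (s : Finset (PBond P j)) (e : ↥s × Fin 3 ≃ Fin n) (x : Fin n → ℝ) : ℝ :=
  ∑ b : ↥s, expLogWeight (fun i => x (e (b, i)))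

/-- `jac_e` is measurable. [folklore] -/
theorem measurable_expJac (e : ↥s × Fin 3 ≃ Fin n) : Measurable (expJac s e) := by
  refine Finset.measurable_sum _ fun b _ => measurable_expLogWeight.comp ?_
  exact measurable_pi_lambda _ fun i => measurable_pi_apply _

/-- A point of the big cube `[-S,S]ⁿ` has every bond block in the small cube `[-S,S]³`. [folklore] -/
theorem regroup_mem_cube (e : ↥s × Fin 3 ≃ Fin n) {S : ℝ} {x : Fin n → ℝ} (hx : x ∈ cube n S) (b : ↥s) :
    regroup s e x b ∈ cube 3 S := by
  have hx' : regroup s e x ∈ Set.pi univ (fun _ : ↥s => cube 3 S) := by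
    rw [← mem_preimage, regroup_preimage_pi_cube]; exact hx
  exact (mem_univ_pi.1 hx') b

/-- The same for the explicit block `(x_{e(b,i)})_i`. [folklore] -/
theorem block_mem_cube (e : ↥s × Fin 3 ≃ Fin n) {S : ℝ} {x : Fin n → ℝ} (hx : x ∈ cube n S) (b : ↥s) :
    (fun i => x (e (b, i))) ∈ cube 3 S := by
  simpa only [regroup_apply_eq] using regroup_mem_cube e hx b

/-- On the big cube `[-S,S]ⁿ` (`3S² < π²`): `e^{-jac_e(x)} = ∏_b w((Ψ_e x)_b)`. [folklore] -/
theorem exp_neg_expJac (e : ↥s × Fin 3 ≃ Fin n) {S : ℝ} (hSπ : 3 * S ^ 2 < π ^ 2) {x : Fin n → ℝ}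
    (hx : x ∈ cube n S) : Real.exp (-expJac s e x) = ∏ b : ↥s, expCubeWeight (regroup s e x b) := by
  rw [expJac, ← Finset.sum_neg_distrib, Real.exp_sum]
  refine Finset.prod_congr rfl fun b _ => ?_
  rw [regroup_apply_eq]
  exact exp_neg_expLogWeight hSπ (block_mem_cube e hx b)

/-- **THE WEIGHTED CUBE, REGROUPED, IS THE PRODUCT OF THE EXPONENTIAL MEASURES** (`3S² < π²`):
`(Ψ_e)_* (e^{-jac_e} 1_{[-S,S]ⁿ} dx) = ⨂_{b ∈ s} w(v) 1_{[-S,S]³} dv` — regrouping preserves Lebesgue measure, carries the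
big cube to the product of small cubes and, ON THE CUBE, the weight `e^{-jac_e}` to the product weight; Tonelli on boxes
and uniqueness of product measures (`Measure.pi_eq`). [folklore] -/
theorem map_regroup_cubeWeighted (e : ↥s × Fin 3 ≃ Fin n) {S : ℝ} (hSπ : 3 * S ^ 2 < π ^ 2) :
    (cubeWeighted n S (expJac s e)).map (regroup s e) = Measure.pi fun _ : ↥s => expCubeMeasure S := by
  symm
  refine Measure.pi_eq fun t ht => ?_
  have hΨ := measurePreserving_regroup e
  have hpre : MeasurableSet (regroup s e ⁻¹' Set.pi univ t) := (regroup s e).measurable (MeasurableSet.univ_pi ht)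
  have hset : regroup s e ⁻¹' Set.pi univ t ∩ cube n S = regroup s e ⁻¹' Set.pi univ (fun b => t b ∩ cube 3 S) := by
    rw [← regroup_preimage_pi_cube e S, ← preimage_inter, ← pi_inter_distrib]
  have hsub : regroup s e ⁻¹' Set.pi univ (fun b => t b ∩ cube 3 S) ⊆ cube n S := by
    rw [← hset]; exact inter_subset_right
  have hwm : Measurable fun v : Fin 3 → ℝ => ENNReal.ofReal (expCubeWeight v) :=
    ENNReal.measurable_ofReal.comp measurable_expCubeWeight
  have hpre' : MeasurableSet (regroup s e ⁻¹' Set.pi univ (fun b => t b ∩ cube 3 S)) :=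
    (regroup s e).measurable (MeasurableSet.univ_pi fun b => (ht b).inter (measurableSet_cube' 3 S))
  rw [MeasurableEquiv.map_apply, cubeWeighted, withDensity_apply _ hpre, Measure.restrict_restrict hpre, hset]
  calc ∫⁻ x in regroup s e ⁻¹' Set.pi univ (fun b => t b ∩ cube 3 S), ENNReal.ofReal (Real.exp (-expJac s e x))
      = ∫⁻ x in regroup s e ⁻¹' Set.pi univ (fun b => t b ∩ cube 3 S),
          ∏ b : ↥s, ENNReal.ofReal (expCubeWeight (regroup s e x b)) := by
        refine setLIntegral_congr_fun hpre' fun x hx => ?_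
        rw [exp_neg_expJac e hSπ (hsub hx), ENNReal.ofReal_prod_of_nonneg fun b _ => expCubeWeight_nonneg _]
    _ = ∫⁻ y in Set.pi univ (fun b => t b ∩ cube 3 S), ∏ b : ↥s, ENNReal.ofReal (expCubeWeight (y b)) :=
        hΨ.setLIntegral_comp_preimage_emb (regroup s e).measurableEmbedding
          (fun y : ↥s → Fin 3 → ℝ => ∏ b : ↥s, ENNReal.ofReal (expCubeWeight (y b))) _
    _ = ∫⁻ y, ∏ b : ↥s, ENNReal.ofReal (expCubeWeight (y b))
          ∂(Measure.pi fun b : ↥s => (volume : Measure (Fin 3 → ℝ)).restrict (t b ∩ cube 3 S)) := by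
        rw [volume_pi, Measure.restrict_pi_pi]
    _ = ∏ b : ↥s, ∫⁻ v in t b ∩ cube 3 S, ENNReal.ofReal (expCubeWeight v) :=
        lintegral_fintype_prod_eq_prod _ fun _ => hwm
    _ = ∏ b : ↥s, expCubeMeasure S (t b) := Finset.prod_congr rfl fun b _ => by
        rw [expCubeMeasure, withDensity_apply _ (ht b), Measure.restrict_restrict (ht b)]

/-- The same as a measure-preserving statement. [folklore] -/
theorem measurePreserving_regroup_cubeWeighted (e : ↥s × Fin 3 ≃ Fin n) {S : ℝ} (hSπ : 3 * S ^ 2 < π ^ 2) :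
    MeasurePreserving (regroup s e) (cubeWeighted n S (expJac s e)) (Measure.pi fun _ : ↥s => expCubeMeasure S) :=
  ⟨(regroup s e).measurable, map_regroup_cubeWeighted e hSπ⟩

end Regroup

/-! ## §4  The `SU(2)` fibre: product exponential window, exponential fibre chart, and the chart hypothesis -/

section Fibre

variable {P : Params} {j : ℕ}

/-- **THE PRODUCT EXPONENTIAL WINDOW** about the reference field `u₀` on the bonds of `s`, as a density:
`χ_{s,u₀,S}(U) = ∏_{b ∈ s} 1[U(b) ∈ expWindow (u₀ b) S]` (`{0,1}`-valued, blind to the bonds outside `s`). [folklore] -/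
def expWindowDensity (s : Finset (PBond P j)) (u₀ : GaugeField P j SU2) (S : ℝ) : Density P j SU2 :=
  fun U => ∏ b ∈ s, (expWindow (u₀ b) S).indicator (fun _ => (1 : ℝ)) (U b)

/-- **THE EXPONENTIAL FIBRE CHART** through `s` about `u₀`, along an enumeration `e : s × Fin 3 ≃ Fin n` of the
coordinates: `x ↦ (b ↦ u₀(b) · exp(ι x_{e(b,·)}))`. [folklore] -/
def expFibreChart (s : Finset (PBond P j)) (u₀ : GaugeField P j SU2) {n : ℕ} (e : ↥s × Fin 3 ≃ Fin n) :
    (Fin n → ℝ) → (↥s → SU2) :=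
  fun x b => expChart (u₀ b) (fun i => x (e (b, i)))

variable {s : Finset (PBond P j)} {u₀ : GaugeField P j SU2} {S : ℝ} {n : ℕ}

/-- The product window is measurable. [folklore] -/
theorem measurable_expWindowDensity (s : Finset (PBond P j)) (u₀ : GaugeField P j SU2) (S : ℝ) :
    Measurable (expWindowDensity s u₀ S) := by
  refine Finset.measurable_prod s fun b _ => ?_
  exact (measurable_const.indicator measurableSet_expWindow).comp (measurable_pi_apply (b : PBond P j))

/-- The product window is non-negative. [folklore] -/
theorem expWindowDensity_nonneg (U : GaugeField P j SU2) : 0 ≤ expWindowDensity s u₀ S U :=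
  Finset.prod_nonneg fun _ _ => Set.indicator_nonneg (fun _ _ => zero_le_one) _

/-- The product window takes values in `[0, 1]`. [folklore] -/
theorem expWindowDensity_le_one (U : GaugeField P j SU2) : expWindowDensity s u₀ S U ≤ 1 :=
  Finset.prod_le_one (fun _ _ => Set.indicator_nonneg (fun _ _ => zero_le_one) _)
    fun _ _ => Set.indicator_apply_le' (fun _ => le_rfl) (fun _ => zero_le_one)

/-- The product window is BLIND outside `s`. [folklore] -/
theorem expWindowDensity_congr {U V : GaugeField P j SU2} (h : ∀ b ∈ s, U b = V b) :
    expWindowDensity s u₀ S U = expWindowDensity s u₀ S V :=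
  Finset.prod_congr rfl fun b hb => by rw [h b hb]

/-- The reference field lies in its own window (`S ≥ 0`): `χ_{s,u₀,S}(u₀) = 1`. [folklore] -/
theorem expWindowDensity_self (u₀ : GaugeField P j SU2) (hS : 0 ≤ S) : expWindowDensity s u₀ S u₀ = 1 :=
  Finset.prod_eq_one fun _ _ => Set.indicator_of_mem (mem_expWindow_self hS) _

/-- The exponential fibre chart factors as the regrouping `ℝⁿ ≃ (s → ℝ³)` followed by the bondwise charts
`v ↦ u₀(b) exp(ι v)`. [folklore] -/
theorem expFibreChart_eq_comp (e : ↥s × Fin 3 ≃ Fin n) :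
    expFibreChart s u₀ e = (fun (y : ↥s → Fin 3 → ℝ) (b : ↥s) => expChart (u₀ b) (y b)) ∘ regroup s e := by
  funext x
  funext b
  simp only [expFibreChart, Function.comp_apply, regroup_apply_eq]

/-- The exponential fibre chart is continuous. [folklore] -/
theorem continuous_expFibreChart (e : ↥s × Fin 3 ≃ Fin n) : Continuous (expFibreChart s u₀ e) :=
  continuous_pi fun b => (continuous_expChart (u₀ b)).comp (continuous_pi fun _ => continuous_apply _)

/-- The exponential fibre chart is measure preserving from the weighted cube `e^{-jac_e} 1_{[-S,S]ⁿ} dx` (`3S² < π²`) to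
the product of the Haar data on the exponential windows. [folklore] -/
theorem measurePreserving_expFibreChart (e : ↥s × Fin 3 ≃ Fin n) (hSπ : 3 * S ^ 2 < π ^ 2) :
    MeasurePreserving (expFibreChart s u₀ e) (cubeWeighted n S (expJac s e))
      (Measure.pi fun b : ↥s => (HaarData.haar : Measure SU2).restrict (expWindow (u₀ b) S)) := by
  rw [expFibreChart_eq_comp]
  exact (measurePreserving_pi (fun _ : ↥s => expCubeMeasure S)
      (fun b : ↥s => (HaarData.haar : Measure SU2).restrict (expWindow (u₀ b) S))
      fun b => measurePreserving_expChart (u₀ b) hSπ).comp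
    (measurePreserving_regroup_cubeWeighted e hSπ)

/-- INJECTIVITY OF THE FIBRE CHART ON THE BIG CUBE (`3S² < π²`). [folklore] -/
theorem injOn_expFibreChart (e : ↥s × Fin 3 ≃ Fin n) (hSπ : 3 * S ^ 2 < π ^ 2) :
    InjOn (expFibreChart s u₀ e) (cube n S) := by
  intro x hx y hy h
  funext k
  obtain ⟨⟨b, i⟩, rfl⟩ := e.surjective k
  have hb : (fun i => x (e (b, i))) = fun i => y (e (b, i)) :=
    injOn_expChart (u₀ b) hSπ (block_mem_cube e hx b) (block_mem_cube e hy b) (congrFun h b)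
  exact congrFun hb i

variable [DecidableEq (PBond P j)]

/-- On the fibre through `s` at the exterior `u₀` the product window is the indicator of the box
`∏_{b ∈ s} expWindow (u₀ b) S`. [folklore] -/
theorem expWindowDensity_updateFinset (y : ↥s → SU2) :
    expWindowDensity s u₀ S (updateFinset u₀ s y) =
      (Set.pi univ fun b : ↥s => expWindow (u₀ b) S).indicator (fun _ => (1 : ℝ)) y := by
  unfold expWindowDensity
  rw [← Finset.prod_coe_sort s]
  have hb : ∀ b : ↥s, updateFinset u₀ s y (b : PBond P j) = y b := fun b => by
    simp [Function.updateFinset, b.2]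
  simp_rw [hb]
  by_cases hy : y ∈ Set.pi univ fun b : ↥s => expWindow (u₀ b) S
  · rw [indicator_of_mem hy]
    exact Finset.prod_eq_one fun b _ => indicator_of_mem (hy b (mem_univ _)) _
  · rw [indicator_of_notMem hy]
    simp only [mem_univ_pi, not_forall] at hy
    obtain ⟨b, hb'⟩ := hy
    exact Finset.prod_eq_zero (Finset.mem_univ b) (indicator_of_notMem hb' _)

/-- The product window is a BLIND WINDOW in the sense of `T4CubeChartTransport.mem_respDom_of_cubeChart` (binder
`hbl`). [folklore] -/
theorem expWindowDensity_blind (u : GaugeField P j SU2) (y : ↥s → SU2) :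
    expWindowDensity s u₀ S (updateFinset u s y) = expWindowDensity s u₀ S (updateFinset u₀ s y) :=
  expWindowDensity_congr fun b hb => by simp [Function.updateFinset, hb]

/-- The same, for the `ℝ≥0∞`-valued weight of `IsCubeImage`. [folklore] -/
theorem ofReal_expWindowDensity_updateFinset :
    (fun y : ↥s → SU2 => ENNReal.ofReal (expWindowDensity s u₀ S (updateFinset u₀ s y))) =
      (Set.pi univ fun b : ↥s => expWindow (u₀ b) S).indicator 1 := by
  funext y
  rw [expWindowDensity_updateFinset]
  by_cases hy : y ∈ Set.pi univ fun b : ↥s => expWindow (u₀ b) S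
  · rw [indicator_of_mem hy, indicator_of_mem hy, ENNReal.ofReal_one, Pi.one_apply]
  · rw [indicator_of_notMem hy, indicator_of_notMem hy, ENNReal.ofReal_zero]

/-- The windowed base law of the `SU(2)` fibre at the reference exterior is the product of the Haar data on the
exponential windows. [folklore] -/
theorem fibreBase_withDensity_expWindowDensity :
    (fibreBase s).withDensity (fun y => ENNReal.ofReal (expWindowDensity s u₀ S (updateFinset u₀ s y))) =
      Measure.pi fun b : ↥s => (HaarData.haar : Measure SU2).restrict (expWindow (u₀ b) S) := by
  rw [ofReal_expWindowDensity_updateFinset,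
    withDensity_indicator_one (MeasurableSet.univ_pi fun _ => measurableSet_expWindow)]
  exact Measure.restrict_pi_pi _ _

/-- **THE CHART HYPOTHESIS HOLDS ON THE `SU(2)` FIBRE IN THE EXPONENTIAL WINDOW** (caveat (CHART) of
`T4CubeChartTransport`, production-type group, exponential chart): for every bond set `s`, reference field `u₀`,
coordinate enumeration `e : s × Fin 3 ≃ Fin n` and half-width `S` with `0 < S`, `3S² < π²`, the windowed base law
`χ_{s,u₀,S}(u₀←y) · Haar^s(dy)` of the fibre through `s` IS the image under the exponential fibre chart
`x ↦ (u₀(b) exp(ι x_{e(b,·)}))_b` of the weighted cube law `e^{-jac_e} 1_{[-S,S]ⁿ} dx` with the NON-constant log-Jacobian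
`jac_e(x) = -Σ_b log((2π²)⁻¹ sinc²|x_{e(b,·)}|)` — an instance of `CubeChart s χ u₀ n S φ jac` with `χ` = the product
exponential window. [folklore] -/
theorem cubeChart_specialUnitaryTwo_exp (s : Finset (PBond P j)) (u₀ : GaugeField P j SU2) (e : ↥s × Fin 3 ≃ Fin n)
    (hS : 0 < S) (hSπ : 3 * S ^ 2 < π ^ 2) :
    CubeChart s (expWindowDensity s u₀ S) u₀ n S (expFibreChart s u₀ e) (expJac s e) where
  S_pos := hS
  measurable_w := (measurable_expWindowDensity s u₀ S).comp measurable_updateFinset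
  nonneg_w _ := expWindowDensity_nonneg _
  measurable_φ := (continuous_expFibreChart e).measurable
  measurable_jac := measurable_expJac e
  map_eq := by
    rw [fibreBase_withDensity_expWindowDensity, (measurePreserving_expFibreChart e hSπ).map_eq]

/-- The same with the canonical enumeration `bondCoordEquiv s` (`n = 3·#s`). [folklore] -/
theorem cubeChart_specialUnitaryTwo_exp_card (s : Finset (PBond P j)) (u₀ : GaugeField P j SU2) (hS : 0 < S)
    (hSπ : 3 * S ^ 2 < π ^ 2) :
    CubeChart s (expWindowDensity s u₀ S) u₀ (s.card * 3) S (expFibreChart s u₀ (bondCoordEquiv s))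
      (expJac s (bondCoordEquiv s)) :=
  cubeChart_specialUnitaryTwo_exp s u₀ (bondCoordEquiv s) hS hSπ

/-- INHABITATION of the hypothesis class `CubeChart` by the production-type fibre in the EXPONENTIAL window: for every
`s`, `u₀` and `0 < S < π/√3` the `SU(2)` fibre has an exponential cube chart in dimension `n = 3·#s`, injective on
the cube. [folklore] -/
theorem exists_cubeChart_specialUnitaryTwo_exp (s : Finset (PBond P j)) (u₀ : GaugeField P j SU2) (hS : 0 < S)
    (hSπ : 3 * S ^ 2 < π ^ 2) :
    ∃ (n : ℕ) (φ : (Fin n → ℝ) → (↥s → SU2)) (jac : (Fin n → ℝ) → ℝ),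
      CubeChart s (expWindowDensity s u₀ S) u₀ n S φ jac ∧ n = s.card * 3 ∧ InjOn φ (cube n S) :=
  ⟨s.card * 3, _, _, cubeChart_specialUnitaryTwo_exp_card s u₀ hS hSπ, rfl, injOn_expFibreChart _ hSπ⟩

end Fibre

/-! ## §5  The window mass — the consumers' provisos for the exponential window -/

section Mass

open T4DressingDefect T4JointDressing B15.BasicStep

variable {P : Params} {j : ℕ} [DecidableEq (PBond P j)]
variable {s : Finset (PBond P j)} {u₀ : GaugeField P j SU2} {S : ℝ}

/-- The fibre law of the product exponential window at the reference exterior is the product of the Haar data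
restricted to the windows (`T4DressingDefect.fibreLaw`). [folklore] -/
theorem fibreLaw_expWindowDensity :
    fibreLaw s (expWindowDensity s u₀ S) u₀ =
      Measure.pi fun b : ↥s => (HaarData.haar : Measure SU2).restrict (expWindow (u₀ b) S) := by
  rw [fibreLaw]
  exact fibreBase_withDensity_expWindowDensity

/-- THE WINDOW MASS in `ℝ≥0∞`: the product over the bonds of the one-bond window masses. [folklore] -/
theorem fibreLaw_expWindowDensity_univ :
    fibreLaw s (expWindowDensity s u₀ S) u₀ Set.univ =
      ∏ b : ↥s, (HaarData.haar : Measure SU2) (expWindow (u₀ b) S) := by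
  rw [fibreLaw_expWindowDensity, Measure.pi_univ]
  simp_rw [Measure.restrict_apply_univ]

/-- **THE WINDOW MASS**: `∫dV⌈_s χ_{s,u₀,S} (u₀) = (∫_{[-S,S]³} w)^{#s}` (`3S² < π²`; `B15.BasicStep.fibreIntegral`) — the
same for every reference field `u₀` (left invariance). [folklore] -/
theorem fibreIntegral_expWindowDensity (hSπ : 3 * S ^ 2 < π ^ 2) :
    fibreIntegral s (expWindowDensity s u₀ S) u₀ = (∫ v in cube 3 S, expCubeWeight v) ^ s.card := by
  rw [← toReal_fibreLaw_univ, fibreLaw_expWindowDensity_univ]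
  simp_rw [haar_expWindow_eq_ofReal _ hSπ]
  rw [Finset.prod_const, Finset.card_univ, Fintype.card_coe, ENNReal.toReal_pow,
    ENNReal.toReal_ofReal (setIntegral_nonneg (measurableSet_cube' 3 S) fun v _ => expCubeWeight_nonneg v)]

/-- … hence `≥ ((2π²)⁻¹ (2/π)² (2S)³)^{#s}` for `0 ≤ S`, `12 S² ≤ π²`. [folklore] -/
theorem le_fibreIntegral_expWindowDensity (hS : 0 ≤ S) (hS12 : 12 * S ^ 2 ≤ π ^ 2) :
    ((2 * π ^ 2)⁻¹ * (2 / π) ^ 2 * (2 * S) ^ 3) ^ s.card ≤ fibreIntegral s (expWindowDensity s u₀ S) u₀ := by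
  have hSπ : 3 * S ^ 2 < π ^ 2 := by nlinarith [pow_pos Real.pi_pos 2, sq_nonneg S]
  rw [fibreIntegral_expWindowDensity hSπ]
  exact pow_le_pow_left₀ (by positivity) (le_integral_expCubeWeight hS hS12) _

/-- **THE WINDOW MASS IS POSITIVE** for `0 < S`, `3S² < π²`. [folklore] -/
theorem fibreIntegral_expWindowDensity_pos (hS : 0 < S) (hSπ : 3 * S ^ 2 < π ^ 2) :
    0 < fibreIntegral s (expWindowDensity s u₀ S) u₀ := by
  rw [← toReal_fibreLaw_univ, fibreLaw_expWindowDensity_univ]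
  exact ENNReal.toReal_pos (Finset.prod_ne_zero_iff.2 fun b _ => (haar_expWindow_pos (u₀ b) hS hSπ).ne')
    (ENNReal.prod_ne_top fun b _ => measure_ne_top _ _)

/-- **THE CONSUMER'S PROVISO FOR THE EXPONENTIAL WINDOW.**  For a bounded exponent `|h| ≤ B` the Gibbs data
`χ_{s,u₀,S}·e^{h}` has POSITIVE window mass at the reference exterior (`T4JointDressing.fibreIntegral_exp_dressed_pos`).
[folklore] -/
theorem fibreIntegral_expWindowDensity_mul_exp_pos (hS : 0 < S) (hSπ : 3 * S ^ 2 < π ^ 2) {h : Density P j SU2}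
    {B : ℝ} (hB : ∀ U, |h U| ≤ B) :
    0 < fibreIntegral s (fun U => expWindowDensity s u₀ S U * Real.exp (h U)) u₀ := by
  simpa only [one_mul] using fibreIntegral_exp_dressed_pos s h (fun U => expWindowDensity_nonneg U)
    (fun U => expWindowDensity_le_one U) hB 1 u₀ (fibreIntegral_expWindowDensity_pos hS hSπ).ne'

/-- … in the shape of the binder `hne : fibreIntegral s (fun U => χ U * Real.exp (h U)) u₀ ≠ 0` of the consumers.
[folklore] -/
theorem fibreIntegral_expWindowDensity_mul_exp_ne_zero (hS : 0 < S) (hSπ : 3 * S ^ 2 < π ^ 2) {h : Density P j SU2}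
    {B : ℝ} (hB : ∀ U, |h U| ≤ B) :
    fibreIntegral s (fun U => expWindowDensity s u₀ S U * Real.exp (h U)) u₀ ≠ 0 :=
  (fibreIntegral_expWindowDensity_mul_exp_pos hS hSπ hB).ne'

omit [DecidableEq (PBond P j)] in
/-- The bound `χ e^{h} ≤ e^{B}` (binder `hC` of the consumers) for the exponential window and `|h| ≤ B`. [folklore] -/
theorem expWindowDensity_mul_exp_le {h : Density P j SU2} {B : ℝ} (hB : ∀ U, |h U| ≤ B) (U : GaugeField P j SU2) :
    expWindowDensity s u₀ S U * Real.exp (h U) ≤ Real.exp B :=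
  (mul_le_of_le_one_left (Real.exp_nonneg _) (expWindowDensity_le_one U)).trans
    (Real.exp_le_exp.2 (abs_le.1 (hB U)).2)

end Mass

end Literature.MathematicalPhysics.QuantumFieldTheory.Balaban1983to89.T4CubeChartExp
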